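import Summits.BirchSwinnertonDyer.BirchSwinnertonDyer.Theses.AdditiveBranchIMC
import HarnessLib

/-!
# K1 route `AdditiveBranchIMC` — `ReadingFacts` child RF-3 `GreenbergVatsalLiftingRamifiedEven`
# (item stmt-BirchSwinnertonDyer-19298) BY NAME: it is a special case of RF-4
# `GreenbergVatsalLiftingEven` (item 19299)

Cell `bsd-addord` (home `run/shared/lean/pub/bsd-addord/`), inputs seat `bsd-inputs-abimc-rf-p2`
(director-bsd g13 (172)(f′); pen = planner g28, REQUESTS l.30191 (C)). HONEST FRAMING: nothing here
proves the Birch–Swinnerton-Dyer conjecture, the crux `ReadingFacts` (19361) or either reading fact;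
BSD is not proved by any of this. The two Greenberg–Vatsal LIFTING conjuncts of `ReadingFacts` are the
Literature reading-facts

* RF-3 `GreenbergVatsalLiftingRamifiedEven :=
  Literature.NumberTheory.EllipticCurves.GreenbergVatsal2000.residualEpsilon_surjOn_of_lineRamifiedEven`
  (GV 2000 §2 p. 28 with p. 30, rational line `Φ₀` RAMIFIED at `p` and EVEN), and
* RF-4 `GreenbergVatsalLiftingEven := ….residualEpsilon_surjOn_of_lineEven` (the same statement with
  the hypothesis `¬ LineUnramifiedAt W p Φ₀` dropped — p. 30's proof of `H²(ℚ_Σ/ℚ_∞, Φ) = 0` uses only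
  the evenness of `φ`; the form needed on the `p = 3` rows).

RF-3 is RF-4 restricted to ramified lines, so RF-3 is DERIVED IN TREE from RF-4 (the Literature
bookkeeping lemma `residualEpsilon_surjOn_of_lineRamifiedEven_of_lineEven`, file
`GreenbergVatsal2000/ResidualLiftingEven.lean`). This file records that derivation against the ROUTE
declarations, so that item 19298 closes by name the day 19299 does, and the crux `ReadingFacts` needs
only FOUR independent readings (`readingFacts_of_four`; cf. the glue `ReadingFactsOfParts`, item 19302).
Size verdict for a direct proof of RF-3/RF-4 (unchanged from the k1-rf D-audit census, first-hand
re-read of `GreenbergVatsal2000/ResidualSelmerGroups.lean`): XL — the statement is the right-exactness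
on `U` of `H¹(ℚ_Σ/ℚ_∞, E[p]) →ε H¹(ℚ_Σ/ℚ_∞, Ψ)` in the tree's continuous-cohomology model
(`subgroupH1 = continuousCohomology 1`), whose printed proof is `H²(ℚ_Σ/ℚ_∞, Φ) = 0` (Iwasawa's
theorem for the even character `φ`, Ferrero–Washington, GV Prop. (2.5), Greenberg 1989 Prop. 4) plus the
long exact cohomology sequence and inflation–restriction for `Gal(ℚ_Σ/ℚ_∞)`; none of `H²`, the long
exact sequence, or `Gal(ℚ_Σ/ℚ_∞)`-cohomology exists in Mathlib/the tree today.

References: [GreenbergVatsal2000] R. Greenberg, V. Vatsal, Invent. Math. 142 (2000), §2 p. 28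
(display `0 → H¹(ℚ_Σ/ℚ_∞, Φ) → H¹(ℚ_Σ/ℚ_∞, E[p]) →ε H¹(ℚ_Σ/ℚ_∞, Ψ) → 0`), p. 30 (`H²(ℚ_Σ/ℚ_∞, Φ) = 0`).
-/

set_option autoImplicit false
-- the problem directory `BirchSwinnertonDyer/BirchSwinnertonDyer` forces a duplicated namespace component
set_option linter.dupNamespace false

namespace Summit.BirchSwinnertonDyer.BirchSwinnertonDyer.Theorems.AdditiveBranchIMCGreenbergVatsalLiftingRamifiedEven

open Summit.BirchSwinnertonDyer.BirchSwinnertonDyer.Theses.AdditiveBranchIMC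
open Literature.NumberTheory.EllipticCurves.GreenbergVatsal2000

/-- **RF-3 ⟸ RF-4 (item 19298 from item 19299, by name).** Greenberg–Vatsal's residual lifting with a
prescribed RAMIFIED even line is the special case of the lifting with a prescribed even line: the
hypothesis `¬ LineUnramifiedAt W p Φ₀` of `residualEpsilon_surjOn_of_lineRamifiedEven` is simply not
used (`residualEpsilon_surjOn_of_lineRamifiedEven_of_lineEven`). CONDITIONAL on the reading fact RF-4;
nothing is discharged. [cite: GreenbergVatsal2000, §2 p. 28 with p. 30] -/
theorem greenbergVatsalLiftingRamifiedEven_of_liftingEven (h : GreenbergVatsalLiftingEven) :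
    GreenbergVatsalLiftingRamifiedEven :=
  residualEpsilon_surjOn_of_lineRamifiedEven_of_lineEven h

/-- **The crux `ReadingFacts` (item 19361) from FOUR of its five conjuncts**: Wuthrich Thm 16
(RF-1), GV Thm (3.12) on the branch (RF-2), the GV lifting for an even line (RF-4) and Delbourgo's
Prop. 4 unit form (RF-5) — the ramified-even lifting RF-3 being RF-4's special case. (The registered
glue `ReadingFactsOfParts`, item 19302, takes all five.) CONDITIONAL on the four named readings.
[cite: GreenbergVatsal2000, §2 p. 28 with p. 30] -/
theorem readingFacts_of_four (h₁ : WuthrichHalfEigenDivisibility) (h₂ : GreenbergVatsalResidualBranch)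
    (h₄ : GreenbergVatsalLiftingEven) (h₅ : DelbourgoPotGoodOrdUnit) : ReadingFacts :=
  ⟨h₁, h₂, greenbergVatsalLiftingRamifiedEven_of_liftingEven h₄, h₄, h₅⟩

/-- **`ReadingFacts` is EQUIVALENT to the conjunction of the four independent readings** RF-1, RF-2,
RF-4, RF-5 (RF-3 is implied by RF-4). Unconditional bookkeeping about the route declarations.
[cite: GreenbergVatsal2000, §2 p. 28 with p. 30] -/
theorem readingFacts_iff_four :
    ReadingFacts ↔ WuthrichHalfEigenDivisibility ∧ GreenbergVatsalResidualBranch ∧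
      GreenbergVatsalLiftingEven ∧ DelbourgoPotGoodOrdUnit :=
  ⟨fun h ↦ ⟨h.1, h.2.1, h.2.2.2.1, h.2.2.2.2⟩,
    fun h ↦ readingFacts_of_four h.1 h.2.1 h.2.2.1 h.2.2.2⟩

end Summit.BirchSwinnertonDyer.BirchSwinnertonDyer.Theorems.AdditiveBranchIMCGreenbergVatsalLiftingRamifiedEven
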